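import Summits.CriticalPhenomena.PercolationContinuityZ3.Theorems.PercNearOneGluingNoHeavyQuantBlockCombTail
import Summits.CriticalPhenomena.PercolationContinuityZ3.Theorems.PercNearOneGluingNoHeavyQuantFarRelayRowBlockComb
import Summits.CriticalPhenomena.PercolationContinuityZ3.Theorems.PercNearOneGluingNoHeavyQuantBlobWalkBottomRoom
import HarnessLib

/-!
# QUANT lane R8, FAR on trees: every BLOCK-COMB in the strong regime `2j < |A| · (private gate)` — p1's merge-induction theorem in the
# ancestor-finset coordinates of `Quant.FarTreeRow` (W1) and in the route vocabulary of `Quant.FarRelayRow` (W2)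

builds on p205010 (kernel theorem, internal audit signed; external expert review pending)

Support file (`--supports stmt-CriticalPhenomena-4575`), QUANT lane typer seat prim-quant-stmt (gen 15), rung R8 of
`run/shared/lean/prim/quant/LADDER.md`; the two wrappers asked for by prim-quant-p1 gen 8 (lane INBOX 2026-08-21T00:17Z (W1)/(W2)) for
`Quant.BlockComb.tail_ge_marg_strong` (`…QuantBlockCombStrong.lean`, p242699: FAR at every layer for the CANONICAL block-comb model in the
strong regime, by the merge induction of P1-SURPLUS §19.3).  Theorems only; no definitions (the `local notation3` `CB[a, p, m]` of
`…QuantBlobWalk.lean`, verbatim), no sorries, standard axioms.  RELATION TO p1 g8's own transports `…QuantFarTreeBlockCombStrong.lean` /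
`…QuantFarRelayRowBlockCombStrong.lean` (simultaneous): there the canonical model is identified with EXPLICIT block-comb data (an injective chain
`ch : Fin D → E`, classes with disjoint private gate sets `G k` — a 'block-comb presentation'; `Quant.BlockCombGate.farTree_blockComb_strong`,
`Quant.farRelayRow_tree_blockComb_strong`, by induction on `D` with one gate split per chain gate); here the statements are in the LITERAL
vocabulary of `Quant.FarTreeRow` (arbitrary ancestor finsets `P` with the forest axioms, a relay set `A`, the comb CONDITION
`P b ≠ P b' → P b ∩ P b' ⊆ P a`, essential ancestor sets in the route form) — the form consumed by `Quant.farTree_blockComb_of_exchange` /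
`Quant.farRelayRow_tree_of_gate` and by g14's equal-gate / bottom-room / top-room cells — and the identification goes through the typer's count law
`Quant.blockComb_count_eq` and `Quant.BlockComb.tail_eq_crossing` (`…QuantBlockCombTail.lean`) instead of a second measure-theoretic induction.

Dictionary (gate coordinates of `Quant.blockComb_count_eq` → p1's model, via `Quant.BlockComb.crossing_ge_marg_strong` of
`…QuantBlockCombTail.lean`): blobs = the fibres `Q 0, …, Q (K−1)` of `P` on `A` off the terminal class, root-first, plus the terminal class as
blob `K` (gate `1`, size `c`); chain gates = the products of `q` over the SEGMENTS `(Q k ∩ P a) ∖ (Q (k−1) ∩ P a)` of the chain `P a` between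
consecutive attachment points (last segment `P a ∖ (Q (K−1) ∩ P a)`), so that blob `k` hangs at level `k+1` with chain weight
`∏_{i ≤ k} qc i = w k` and the terminal blob has weight `x = ∏_{P a} q`; total size `Σ sz + c = |A|`.

* `Quant.prod_segments_eq` — the telescoping of the segment products along a nested chain of finsets.
* `Quant.farTree_blockComb_strong_enum` — enumerated data as in `Quant.blockComb_count_eq`; if `2j < |A| · p k` for every blob and `2j < |A|`,
  then SOME relay `b ∈ A` has `∏_{P b} q ≤ P(N ≥ j+1)`.
* `Quant.farTree_blockComb_strong` — **FAR AT EVERY LAYER FOR BLOCK-COMBS IN THE STRONG REGIME (gate coordinates):** ancestor finsets of a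
  rooted forest (`y ∈ P x → P y ⊆ P x`; members of `P x` pairwise comparable), relays `A ∋ a`, BLOCK-COMB around `a` (`P b ≠ P b' →
  P b ∩ P b' ⊆ P a` on `A`), STRONG REGIME `2j < |A| · ∏_{P b ∖ P a} q` for every `b ∈ A`; then `1 − ∏_{P b} q ≤ t` on `A` gives
  `P(#{b ∈ A : ↑(P b) ⊆ ω} ≤ j) ≤ t` — `Quant.FarTreeRow`'s conclusion, with NO mean hypothesis and no least-likely normalisation (the chain
  owner `a` is any relay the comb is combed around).  Contains every ALL-TIED block-comb (`EN = |A|·x > 2j`), '(FO′)-mono', `|A|·x > 2j`.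
* `Quant.farTree_blockComb_strong_essential` — the same read on the ESSENTIAL ancestor sets `{y ∈ P x | q y ≠ 1}` (glued classes as weight-one
  paths, the shape of `Quant.tree_ancestor_axioms`).
* `Quant.farRelayRow_tree_blockComb_strongGates` — **(W2) the body of `Quant.FarRelayRow` at every layer** for tree-supported weights on the pairs of
  `Fin n` whose relays form a block-comb around `a` in the strong regime (`o ∉ A`), via the typer's generic transfer `Quant.farRelayRow_tree_of_gate`.
Honest scope (p1 g8): the WEAK-hypothesis row `EN > 2j` for non-tied block-combs (the budget-boundary staircases of LEAD-NOTES-G10 N21 (6)) is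
not claimed; forests with two relay-free roots and no root-level blob are outside the merge induction (conjecture (GM), P1-SURPLUS §19.4).
[this work]; [cite: KozmaNitzan2024, Conjecture 3 (p. 15)] (the gluing rows `Quant.FarTreeRow` serves); product measure [cite: Grimmett1999, §1.3 p. 10].
-/

noncomputable section

namespace Summit.CriticalPhenomena.PercolationContinuityZ3.Theorems

namespace Quant

open Finset MeasureTheory
open Literature.Probability.LatticeModels
open Literature.Probability.Percolation
open scoped Classical

/-- `CB[a, p, m] t` = probability that the open mass of the first `m` blobs (sizes `a`, gates `p`) is `≤ t` (the recursion of
`…QuantBlobWalk.lean`, verbatim). -/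
local notation3 "CB[" a ", " p ", " m "]" =>
  (Nat.rec (motive := fun _ => ℤ → ℝ) (fun t => if (0 : ℤ) ≤ t then (1 : ℝ) else 0)
    (fun n f t => (p : ℕ → ℝ) n * f (t - ((a : ℕ → ℕ) n : ℤ)) + (1 - (p : ℕ → ℝ) n) * f t) (m : ℕ))

variable {ι : Type*} [Fintype ι] [DecidableEq ι]

/-! ### Segments of a nested chain -/

omit [Fintype ι] in
/-- **Telescoping of segment products.**  For finsets `C 0 ⊆ C 1 ⊆ ⋯ ⊆ C K` (nested on `[0, K]`) and any real weights `f`, the product over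
`C k` is the product of the products over the segments `C i ∖ C (i−1)`, `i ≤ k` (`C (−1) = ∅`). [folklore] -/
theorem prod_segments_eq (C : ℕ → Finset ι) (K : ℕ) (hC : ∀ k, k + 1 ≤ K → C k ⊆ C (k + 1)) (f : ι → ℝ) :
    ∀ k, k ≤ K → ∏ i ∈ Finset.range (k + 1), (∏ y ∈ C i \ (if i = 0 then ∅ else C (i - 1)), f y) = ∏ y ∈ C k, f y := by
  intro k
  induction k with
  | zero => intro _; simp
  | succ k ih =>
    intro hk
    rw [Finset.prod_range_succ, ih (by omega), if_neg (by omega), Nat.add_sub_cancel, mul_comm]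
    exact Finset.prod_sdiff (hC k hk)

/-! ### The strong regime, enumerated data -/

/-- **FAR in the strong regime — enumerated block-comb data** (as in `Quant.blockComb_count_eq`: chain `P a`, `x = ∏_{P a} q`, terminal class of
size `c`, blobs `Q 0 … Q (K−1)` root-first with sizes `sz`, private gates `p`, chain weights `w`).  If `2j < |A| · p k` for every `k < K` and
`2j < |A|`, then some relay `b ∈ A` has `∏_{P b} q ≤ P(#{y ∈ A : ↑(P y) ⊆ ω} ≥ j+1)`.  Proof: `Quant.blockComb_count_eq` at `t = j`, the segment
chain, `Quant.BlockComb.crossing_ge_marg_strong`. [this work] -/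
theorem farTree_blockComb_strong_enum (P : ι → Finset ι) (q : ι → unitInterval) (a : ι) (x : ℝ)
    (hx : x = ∏ y ∈ P a, (q y : ℝ)) (K : ℕ) (A : Finset ι) (Q : ℕ → Finset ι) (sz : ℕ → ℕ) (c : ℕ) (p w : ℕ → ℝ)
    (ha : a ∈ A) (hc : c = (A.filter fun y => P y = P a).card)
    (hsz : ∀ k, k < K → sz k = (A.filter fun y => P y = Q k).card)
    (hcover : ∀ y ∈ A, P y = P a ∨ ∃ k, k < K ∧ P y = Q k)
    (hQne : ∀ k, k < K → Q k ≠ P a)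
    (hinj : ∀ k k', k < K → k' < K → Q k = Q k' → k = k')
    (hmono : ∀ k k', k ≤ k' → k' < K → Q k ∩ P a ⊆ Q k' ∩ P a)
    (hdisj : ∀ k k', k < K → k' < K → k ≠ k' → Q k ∩ Q k' ⊆ P a)
    (hpdef : ∀ k, p k = ∏ y ∈ Q k \ P a, (q y : ℝ))
    (hwdef : ∀ k, w k = ∏ y ∈ Q k ∩ P a, (q y : ℝ)) (j : ℕ)
    (hstrong : ∀ k, k < K → (2 * j : ℝ) < (A.card : ℝ) * p k) (hstrongc : (2 * j : ℝ) < A.card) :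
    ∃ b ∈ A, ∏ y ∈ P b, (q y : ℝ) ≤
      (prodBernoulli q).real
        {ω : Set ι | (j : ℤ) + 1 ≤ (((A.filter fun y => ((P y : Finset ι) : Set ι) ⊆ ω).card : ℕ) : ℤ)} := by
  have hq0 : ∀ y, (0 : ℝ) ≤ q y := fun y => (q y).2.1
  have hq1 : ∀ y, (q y : ℝ) ≤ 1 := fun y => (q y).2.2
  have hprod01 : ∀ s : Finset ι, 0 ≤ ∏ y ∈ s, (q y : ℝ) ∧ ∏ y ∈ s, (q y : ℝ) ≤ 1 := fun s =>
    ⟨Finset.prod_nonneg fun y _ => hq0 y, Finset.prod_le_one (fun y _ => hq0 y) fun y _ => hq1 y⟩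
  have hp01 : ∀ k, 0 ≤ p k ∧ p k ≤ 1 := fun k => by rw [hpdef k]; exact hprod01 _
  -- the count law at `t = j`
  have hcount := blockComb_count_eq P q a x hx K A Q sz c p w ha hc hsz hcover hQne hinj hmono hdisj hpdef hwdef
    (j : ℤ) (Int.natCast_nonneg j)
  rw [hcount]
  -- the levelled model: blobs `0..K−1` and the terminal block as blob `K`
  set sz' : ℕ → ℕ := fun k => if k < K then sz k else c with hsz'
  set p' : ℕ → ℝ := fun k => if k < K then p k else 1 with hp'
  set C : ℕ → Finset ι := fun k => if k < K then Q k ∩ P a else P a with hC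
  set qc : ℕ → ℝ := fun i => ∏ y ∈ C i \ (if i = 0 then ∅ else C (i - 1)), (q y : ℝ) with hqc
  have hp'01 : ∀ k, 0 ≤ p' k ∧ p' k ≤ 1 := fun k => by
    by_cases hk : k < K
    · simp only [hp', if_pos hk]; exact hp01 k
    · simp only [hp', if_neg hk]; norm_num
  have hqc01 : ∀ i, 0 ≤ qc i ∧ qc i ≤ 1 := fun i => hprod01 _
  have hCmono : ∀ k, k + 1 ≤ K → C k ⊆ C (k + 1) := by
    intro k hk
    by_cases hk' : k + 1 < K
    · simp only [hC, if_pos (show k < K by omega), if_pos hk']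
      exact hmono k (k + 1) (by omega) hk'
    · simp only [hC, if_pos (show k < K by omega), if_neg hk']
      exact Finset.inter_subset_right
  have hW : ∀ k, k ≤ K → ∏ i ∈ Finset.range (k + 1), qc i = ∏ y ∈ C k, (q y : ℝ) :=
    prod_segments_eq C K hCmono (fun y => (q y : ℝ))
  have hWk : ∀ k, k < K → (∏ i ∈ Finset.range (k + 1), qc i) = w k := fun k hk => by
    rw [hW k hk.le]; simp only [hC, if_pos hk]; exact (hwdef k).symm
  have hWK : (∏ i ∈ Finset.range (K + 1), qc i) = x := by
    rw [hW K le_rfl]; simp only [hC, lt_irrefl, if_false]; exact hx.symm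
  -- total size `Σ sz + c = |A|` (the marginal bookkeeping at unit gates)
  have htot : ((∑ k' ∈ Finset.range (K + 1), sz' k' : ℕ) : ℝ) = A.card := by
    have h1 := blockComb_sum_marginals P (fun _ => (1 : unitInterval)) a K A Q sz c hc hsz hcover hQne hinj
    simp only [Set.Icc.coe_one, Finset.prod_const_one, mul_one, Finset.sum_const, nsmul_eq_mul] at h1
    have h2 : ∑ k' ∈ Finset.range (K + 1), sz' k' = (∑ k' ∈ Finset.range K, sz k') + c := by
      rw [Finset.sum_range_succ]
      congr 1
      · exact Finset.sum_congr rfl fun k hk => by simp only [hsz', if_pos (Finset.mem_range.1 hk)]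
      · simp only [hsz', lt_irrefl, if_false]
    rw [h2, h1]; push_cast; ring
  -- p1's theorem in crossing form
  have hstrong' : ∀ k, k < K + 1 → 0 < sz' k →
      (2 * j : ℝ) < ((∑ k' ∈ Finset.range (K + 1), sz' k' : ℕ) : ℝ) * p' k := by
    intro k hk _
    rw [htot]
    by_cases hkK : k < K
    · simp only [hp', if_pos hkK]; exact hstrong k hkK
    · simp only [hp', if_neg hkK, mul_one]; exact hstrongc
  have hcpos : 0 < c := by
    rw [hc]; exact Finset.card_pos.2 ⟨a, Finset.mem_filter.2 ⟨ha, rfl⟩⟩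
  have hne' : ∃ k, k < K + 1 ∧ 0 < sz' k := ⟨K, by omega, by simp only [hsz', lt_irrefl, if_false]; exact hcpos⟩
  obtain ⟨k, hk, hlive, hle⟩ := BlockComb.crossing_ge_marg_strong (K + 1) sz' p' hp'01 qc hqc01 j hstrong' hne'
  -- identify the two crossing sums
  have hCB : ∀ m, m ≤ K → ∀ t : ℤ, CB[sz', p', m] t = CB[sz, p, m] t := fun m hm t =>
    BlobWalk.CB_congr₂ sz' sz p' p m (fun i hi => by simp only [hsz', if_pos (show i < K by omega)])
      (fun i hi => by simp only [hp', if_pos (show i < K by omega)]) t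
  have hsum : ∑ k ∈ Finset.range (K + 1), (∏ i ∈ Finset.range (k + 1), qc i) * p' k *
        (CB[sz', p', k] (j : ℤ) - CB[sz', p', k] ((j : ℤ) - (sz' k : ℤ))) =
      ∑ k ∈ Finset.range K, w k * p k * (CB[sz, p, k] (j : ℤ) - CB[sz, p, k] ((j : ℤ) - (sz k : ℤ))) +
        x * (CB[sz, p, K] (j : ℤ) - CB[sz, p, K] ((j : ℤ) - (c : ℤ))) := by
    rw [Finset.sum_range_succ, hWK, hCB K le_rfl, hCB K le_rfl]
    simp only [hsz', hp', lt_irrefl, if_false, mul_one]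
    congr 1
    refine Finset.sum_congr rfl fun k hk => ?_
    have hkK := Finset.mem_range.1 hk
    rw [hWk k hkK, hCB k hkK.le, hCB k hkK.le, if_pos hkK, if_pos hkK]
  rw [hsum] at hle
  -- the live blob `k` is a relay class
  by_cases hkK : k < K
  · have hszk : 0 < sz k := by simpa only [hsz', if_pos hkK] using hlive
    rw [hsz k hkK] at hszk
    obtain ⟨b, hb⟩ := Finset.card_pos.1 hszk
    obtain ⟨hbA, hbQ⟩ := Finset.mem_filter.1 hb
    refine ⟨b, hbA, ?_⟩
    have hp'k : p' k = p k := by simp only [hp', if_pos hkK]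
    have hmarg : ∏ y ∈ P b, (q y : ℝ) = (∏ i ∈ Finset.range (k + 1), qc i) * p' k := by
      rw [hWk k hkK, hp'k, hbQ, hwdef k, hpdef k]
      exact (Finset.prod_inter_mul_prod_sdiff (Q k) (P a) fun z => (q z : ℝ)).symm
    rw [hmarg]; exact hle
  · have hkK' : k = K := by omega
    subst hkK'
    refine ⟨a, ha, ?_⟩
    rw [hWK] at hle
    simp only [hp', lt_irrefl, if_false, mul_one] at hle
    rw [← hx]; exact hle

/-! ### The strong regime, gate coordinates of `Quant.FarTreeRow` -/

/-- **FAR AT EVERY LAYER FOR BLOCK-COMBS IN THE STRONG REGIME** (gate coordinates of `Quant.FarTreeRow`; = p1 g8's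
`Quant.BlockComb.tail_ge_marg_strong` transferred).  Ancestor finsets `P` of a rooted forest (`y ∈ P x → P y ⊆ P x`; members of `P x`
pairwise comparable), gates `q`, relays `A ∋ a`; BLOCK-COMB around `a`: distinct fibres of `P` on `A` meet only inside the chain `P a`
(`P b ≠ P b' → P b ∩ P b' ⊆ P a`); STRONG REGIME: `2j < |A| · ∏_{P b ∖ P a} q` for every `b ∈ A` (for the terminal class this reads `2j < |A|`).
Then `1 − ∏_{P b} q ≤ t` for all `b ∈ A` gives `P(#{b ∈ A : ↑(P b) ⊆ ω} ≤ j) ≤ t`.  No mean hypothesis is needed (it is implied where it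
matters) and `a` need not be least likely. [this work] -/
theorem farTree_blockComb_strong (P : ι → Finset ι)
    (h2 : ∀ x, ∀ y ∈ P x, P y ⊆ P x) (h3 : ∀ x, ∀ y ∈ P x, ∀ z ∈ P x, y ∈ P z ∨ z ∈ P y)
    (q : ι → unitInterval) (A : Finset ι) (j : ℕ) (t : ℝ) (a : ι) (ha : a ∈ A)
    (hcomb : ∀ b ∈ A, ∀ b' ∈ A, P b ≠ P b' → P b ∩ P b' ⊆ P a)
    (hstrong : ∀ b ∈ A, (2 * j : ℝ) < (A.card : ℝ) * ∏ y ∈ P b \ P a, (q y : ℝ))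
    (ht : ∀ b ∈ A, 1 - ∏ y ∈ P b, (q y : ℝ) ≤ t) :
    (prodBernoulli q).real {ω : Set ι | (A.filter fun b => ((P b : Finset ι) : Set ι) ⊆ ω).card ≤ j} ≤ t := by
  have hmeas : ∀ T : Set (Set ι), MeasurableSet T := fun T => (Set.toFinite T).measurableSet
  -- enumerate the fibres of `P` off the terminal block, root-first
  set S : Finset (Finset ι) := (A.image P).erase (P a) with hS
  obtain ⟨Q, hQmem, hQinj, hQcov, hQmono⟩ :=
    exists_enum_mono (fun Q : Finset ι => (Q ∩ P a).card) (P a) S.card S rfl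
  set K := S.card with hK
  have hQS : ∀ k, k < K → Q k ≠ P a ∧ ∃ y ∈ A, P y = Q k := fun k hk => by
    obtain ⟨hne, hmem⟩ := Finset.mem_erase.1 (hQmem k hk)
    obtain ⟨y, hy, hyQ⟩ := Finset.mem_image.1 hmem
    exact ⟨hne, y, hy, hyQ⟩
  set x : ℝ := ∏ y ∈ P a, (q y : ℝ) with hx
  set sz : ℕ → ℕ := fun k => (A.filter fun y => P y = Q k).card with hsz
  set c : ℕ := (A.filter fun y => P y = P a).card with hc
  set p : ℕ → ℝ := fun k => ∏ y ∈ Q k \ P a, (q y : ℝ) with hp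
  set w : ℕ → ℝ := fun k => ∏ y ∈ Q k ∩ P a, (q y : ℝ) with hw
  have hcover : ∀ y ∈ A, P y = P a ∨ ∃ k, k < K ∧ P y = Q k := by
    intro y hy
    by_cases h : P y = P a
    · exact Or.inl h
    · obtain ⟨k, hk, hkQ⟩ := hQcov (P y) (Finset.mem_erase.2 ⟨h, Finset.mem_image_of_mem P hy⟩)
      exact Or.inr ⟨k, hk, hkQ.symm⟩
  have hmono : ∀ k k', k ≤ k' → k' < K → Q k ∩ P a ⊆ Q k' ∩ P a := by
    intro k k' hkk' hk'
    obtain ⟨_, y, _, hyQ⟩ := hQS k (by omega)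
    obtain ⟨_, y', _, hy'Q⟩ := hQS k' hk'
    rw [← hyQ, ← hy'Q]
    refine subset_of_nested_of_card_le (comb_downsets_nested P h2 h3 a y y') ?_
    rw [hyQ, hy'Q]; exact hQmono k k' hkk' hk'
  have hdisj : ∀ k k', k < K → k' < K → k ≠ k' → Q k ∩ Q k' ⊆ P a := by
    intro k k' hk hk' hne
    obtain ⟨_, y, hy, hyQ⟩ := hQS k hk
    obtain ⟨_, y', hy', hy'Q⟩ := hQS k' hk'
    rw [← hyQ, ← hy'Q]
    refine hcomb y hy y' hy' fun h => hne (hQinj k k' hk hk' ?_)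
    rw [← hyQ, ← hy'Q, h]
  have hstrong' : ∀ k, k < K → (2 * j : ℝ) < (A.card : ℝ) * p k := by
    intro k hk
    obtain ⟨_, y, hy, hyQ⟩ := hQS k hk
    simp only [hp]
    rw [← hyQ]
    exact hstrong y hy
  have hstrongc : (2 * j : ℝ) < A.card := by
    have := hstrong a ha
    rwa [Finset.sdiff_self, Finset.prod_empty, mul_one] at this
  obtain ⟨b, hb, hle⟩ := farTree_blockComb_strong_enum P q a x hx K A Q sz c p w ha hc (fun k _ => rfl) hcover
    (fun k hk => (hQS k hk).1) hQinj hmono hdisj (fun k => rfl) (fun k => rfl) j hstrong' hstrongc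
  rw [blockComb_light_eq_compl P A j, probReal_compl_eq_one_sub (hmeas _)]
  linarith [ht b hb]

/-- **The strong regime read on the ESSENTIAL ancestor sets** `{y ∈ P x | q y ≠ 1}` (sure gates erased; glued classes may be paths of
weight-one gates, the shape delivered by `Quant.tree_ancestor_axioms`): block-comb and strong-regime hypotheses on the essential sets, cuts
`1 − ∏_{P b} q ≤ t` on `A` ⟹ `P(#{b ∈ A : ↑(P b) ⊆ ω} ≤ j) ≤ t`. [this work] -/
theorem farTree_blockComb_strong_essential {m : ℕ} (P : Fin m → Finset (Fin m))
    (h2 : ∀ x, ∀ y ∈ P x, P y ⊆ P x) (h3 : ∀ x, ∀ y ∈ P x, ∀ z ∈ P x, y ∈ P z ∨ z ∈ P y)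
    (q : Fin m → unitInterval) (A : Finset (Fin m)) (j : ℕ) (t : ℝ) (a : Fin m) (ha : a ∈ A)
    (hcomb : ∀ b ∈ A, ∀ b' ∈ A, (P b).filter (fun y => q y ≠ 1) ≠ (P b').filter (fun y => q y ≠ 1) →
      (P b).filter (fun y => q y ≠ 1) ∩ (P b').filter (fun y => q y ≠ 1) ⊆ (P a).filter (fun y => q y ≠ 1))
    (hstrong : ∀ b ∈ A, (2 * j : ℝ) < (A.card : ℝ) *
      ∏ y ∈ (P b).filter (fun y => q y ≠ 1) \ (P a).filter (fun y => q y ≠ 1), (q y : ℝ))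
    (ht : ∀ b ∈ A, 1 - ∏ y ∈ P b, (q y : ℝ) ≤ t) :
    (prodBernoulli q).real {ω : Set (Fin m) | (A.filter fun b => ((P b : Finset (Fin m)) : Set (Fin m)) ⊆ ω).card ≤ j} ≤ t := by
  rw [light_real_eq_essential q P A j]
  obtain ⟨h2', h3'⟩ := essential_axioms q P h2 h3
  have hprod : ∀ b, ∏ y ∈ (P b).filter (fun y => q y ≠ 1), (q y : ℝ) = ∏ y ∈ P b, (q y : ℝ) :=
    fun b => prod_filter_ne_one_eq q (P b)
  exact farTree_blockComb_strong (fun x => (P x).filter fun y => q y ≠ 1) h2' h3' q A j t a ha hcomb hstrong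
    (fun b hb => by rw [hprod]; exact ht b hb)

/-! ### (W2) The strong regime in the route vocabulary -/

/-- **FAR AT EVERY LAYER FOR BLOCK-COMBS IN THE STRONG REGIME, route vocabulary (`o ∉ A`).**  Weights on the pairs of `Fin n` supported on a
rooted spanning tree (`par`/`depth` coordinates of `Quant.tree_cluster_transfer`; weight `0` prunes); ESSENTIAL ancestor sets
`E b = {par^[i] b | i ≤ depth b, w s(par ·, ·) ≠ 1}`; relays `A ∌ o` combed around `a ∈ A`: BLOCK-COMB `E b ≠ E b' → E b ∩ E b' ⊆ E a` on `A`
(every relay class off the path `o → a` hangs off that path by its own private gates); STRONG REGIME `2j < |A| · ∏_{y ∈ E b ∖ E a} w s(par y, y)`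
for every `b ∈ A`.  Then `P(o ↮ b) ≤ t` on `A` gives `P(#{b ∈ A | o ↔ b} ≤ j) ≤ t` — the body of `Quant.FarRelayRow` on this family, every
layer, with no mean hypothesis (p1 g8's theorem ∘ the typer's transfer `Quant.farRelayRow_tree_of_gate`). [this work] -/
theorem farRelayRow_tree_blockComb_strongGates (n : ℕ) (w : Sym2 (Fin n) → unitInterval) (o : Fin n)
    (depth : Fin n → ℕ) (par : Fin n → Fin n)
    (hroot : ∀ x, x ≠ o → depth x = 0 → par x = o)
    (hstep : ∀ x, x ≠ o → depth x ≠ 0 → par x ≠ o ∧ depth (par x) + 1 = depth x)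
    (hsupp : ∀ e, w e ≠ 0 → e.IsDiag ∨ ∃ x, x ≠ o ∧ e = s(par x, x))
    (E : Fin n → Finset (Fin n))
    (hE : ∀ b, b ≠ o → E b = ((Finset.range (depth b + 1)).image (fun i => par^[i] b)).filter fun y => w s(par y, y) ≠ 1)
    (A : Finset (Fin n)) (hoA : o ∉ A) (a : Fin n) (ha : a ∈ A)
    (hcomb : ∀ b ∈ A, ∀ b' ∈ A, E b ≠ E b' → E b ∩ E b' ⊆ E a)
    (j : ℕ) (hstrong : ∀ b ∈ A, (2 * j : ℝ) < (A.card : ℝ) * ∏ y ∈ E b \ E a, (w s(par y, y) : ℝ))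
    (t : ℝ) (ht : ∀ b ∈ A, (prodBernoulli w).real (openConn o b : Set (BondConfig (Fin n)))ᶜ ≤ t) :
    (prodBernoulli w).real {ω : BondConfig (Fin n) | (A.filter fun b => ω ∈ openConn o b).card ≤ j} ≤ t := by
  have hAo : ∀ b ∈ A, b ≠ o := fun b hb hbo => hoA (hbo ▸ hb)
  refine farRelayRow_tree_of_gate n w o depth par hroot hstep hsupp A hoA j t fun q P hq hqo hP h1 h2 h3 hmarg => ?_
  -- the essential ancestor sets of the relays are the `E b`
  have hPE : ∀ b ∈ A, (P b).filter (fun y => q y ≠ 1) = E b := by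
    intro b hb
    have hbo := hAo b hb
    rw [hE b hbo, hP b hbo]
    refine Finset.filter_congr fun y hy => ?_
    rw [hq y (tree_mem_ancestors_ne_root o depth par hstep b hbo y hy)]
  have hqE : ∀ b ∈ A, ∀ y ∈ E b, (q y : ℝ) = w s(par y, y) := by
    intro b hb y hy
    have hbo := hAo b hb
    rw [hE b hbo] at hy
    rw [hq y (tree_mem_ancestors_ne_root o depth par hstep b hbo y (Finset.mem_filter.1 hy).1)]
  refine farTree_blockComb_strong_essential P h2 h3 q A j t a ha ?_ ?_ ?_
  · intro b hb b' hb'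
    rw [hPE b hb, hPE b' hb', hPE a ha]
    exact hcomb b hb b' hb'
  · intro b hb
    rw [hPE b hb, hPE a ha]
    have hprod : ∏ y ∈ E b \ E a, (q y : ℝ) = ∏ y ∈ E b \ E a, (w s(par y, y) : ℝ) :=
      Finset.prod_congr rfl fun y hy => hqE b hb y (Finset.mem_sdiff.1 hy).1
    rw [hprod]; exact hstrong b hb
  · intro b hb
    rw [hmarg b (hAo b hb), ← probReal_compl_eq_one_sub (Set.toFinite _).measurableSet]
    exact ht b hb

end Quant

end Summit.CriticalPhenomena.PercolationContinuityZ3.Theorems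

end
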